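/-
Copyright (c) 2026. All rights reserved.
Released under Apache 2.0 license as described in the file LICENSE.
Authors: abc-iut cell, discharge seat abc-iut-w4-d095 (wave 4, gen 3).
-/
import Mathlib.CategoryTheory.Types.Basic
import Literature.AnabelianGeometry.AbsoluteAnabelian.LogFrobeniusMonoCoresProofs
import HarnessLib

/-!
# [AbsTopIII] Corollary 5.10 (iv)(a) "Mono-analytic Cores" (`Cor510MonoCores`, FACT-LIST F-0138): kernel calibration — an instance form exists over every nonempty index set; none over an empty one

S. Mochizuki, *Topics in absolute anabelian geometry III: global reconstruction algorithms*,
J. Math. Sci. Univ. Tokyo 22 (2015) 939–1156 [MochizukiAbsTopIII2015]; locators `p.N` = pages of the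
author's manuscript (`paper:url-5493eb38cbb7`): Cor 5.10 (iv)(a) p. 147 ("for `n = 5, 6, 7`, `D•⊢_{≤n}` admits a natural
structure of core on the subdiagram of categories of `D•⊢` determined by the union `D•⊢_{≤n-1} ∪ D•_{≤n}`"), Rmk 5.2.2
p. 121.  (Doc-only v2: the Cor 5.10 (iv)(a) quotation restored to print's wording — referee L12-n26; declarations
byte-identical.)

PROOF-ONLY companion of `LogFrobeniusCorollaries.lean` (abc-iut-L4-t3: the `Prop` `LogFrobeniusSetting.Cor510MonoCores`;
FACT-LIST F-0138, class «universal-closure REFUTED / schema; instance forms open or model-witnessed») and of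
`LogFrobeniusMonoCoresProofs.lean` (abc-iut-L4-t10 lineage: `cor510MonoCores_of` — the three mono-analytic cores for EVERY setting
with `V(F_mod) ≠ ∅` MODULO two homotopy inputs `hN` (`𝒩_v → 𝒩⊢_v → ℰ⊢ ≅ 𝒩_v → ℰ• → ℰ⊢`) and `hκ` (rows 6 → 7 over `ℰ⊢`,
Rmk 5.2.2); and `not_cor510MonoCores_of_isEmpty`).  Kernel facts (same DEGENERATE calibration device as this seat's
F-0141 / F-0155 / F-0159 files: the diagonal setting on a large category `C` — all rows `C`, all structure functors `𝟭 C`, all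
equivalences `refl`, all 2-cells identities — at which `hN`, `hκ` hold by `Iso.refl`):

* `LogFrobeniusSetting.exists_cor510MonoCores` — over every NONEMPTY index set some setting satisfies the typed Cor 5.10 (iv)(a)
  (an INSTANCE FORM of F-0138 is model-witnessed, degenerate);
* `LogFrobeniusSetting.exists_cor510MonoCores_iff_nonempty` — and none over an empty one (abc-iut-L4-t10's
  `not_cor510MonoCores_of_isEmpty` holds for EVERY setting): the row is satisfiable exactly when `V(F_mod) ≠ ∅`, which a number
  field always presents.

Refereed pre-IUT anabelian geometry; nothing here bears on [IUTchIII] Cor. 3.12; calibration of typed statements only (no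
arithmetic content); typed ≠ proved.
-/

universe u

open CategoryTheory

namespace Literature.AnabelianGeometry.AbsoluteAnabelian

namespace LogFrobeniusSetting

variable (Vmod : Type u) (isArc : Vmod → Bool)

/-- `Λ_ν ∘ 𝟭 = 𝟭` for `log = 𝟭` (the typing of `ι⊞_{v,ε}` at the diagonal setting).
[cite: MochizukiAbsTopIII2015, Def 5.4 (vii) p. 128] -/
private theorem frobeniusTwist_id_comp_id'' {C : Type (u + 1)} [Category.{u} C] (b : Bool) :
    frobeniusTwist (𝟭 C) b ⋙ 𝟭 C = 𝟭 C := by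
  cases b <;> rfl

/-- **An instance form of Cor 5.10 (iv)(a) over every nonempty index set**: the diagonal setting on a large category
`C` (all structure functors identities) meets the two homotopy inputs `hN`, `hκ` of abc-iut-L4-t10's `cor510MonoCores_of` by
identity isomorphisms, so its mono-analytic rows `ℰ⊢`, `An⊢[𝒩⊢⊞]`, `ℰ⊢` are cores of `D•⊢_{≤n-1} ∪ D•_{≤n}`, `n = 5, 6, 7`.
DEGENERATE calibration witness (no arithmetic content). [cite: MochizukiAbsTopIII2015, Cor 5.10 (iv)(a) p. 147] -/
theorem exists_cor510MonoCores [Nonempty Vmod] (C : Type (u + 1)) [Category.{u} C] :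
    ∃ L : LogFrobeniusSetting Vmod isArc, L.X = C ∧ L.Cor510MonoCores := by
  let L₀ : LogFrobeniusSetting Vmod isArc :=
    { X := C
      E := C
      proj := 𝟭 C
      log := 𝟭 C
      logIsoId := Iso.refl _
      logOver := Iso.refl _
      Nplus := fun _ => C
      N := fun _ => C
      forget := fun _ => 𝟭 C
      toE := fun _ => 𝟭 C
      lam := fun _ _ => 𝟭 C
      lamOver := fun _ _ => Iso.refl _
      lam_spaceLink_eq_postLog := fun _ => rfl
      iota := fun _ ν₁ _ _ => eqToHom (frobeniusTwist_id_comp_id'' ν₁.isPostLog)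
      An := C
      κAn := CategoryTheory.Equivalence.refl
      φAn := 𝟭 C
      φAn_isEquivalence := inferInstance
      ηAn := Iso.refl _
      κAn₂ := CategoryTheory.Equivalence.refl
      Emono := C
      monoAn := 𝟭 C
      NmonoPlus := fun _ => C
      Nmono := fun _ => C
      forgetMono := fun _ => 𝟭 C
      toEmono := fun _ => 𝟭 C
      monoNplus := fun _ => 𝟭 C
      monoN := fun _ => 𝟭 C
      monoHomotopy := fun _ => Iso.refl _
      AnMono := C
      κAnMono := CategoryTheory.Equivalence.refl
      ψAnMono := fun _ _ => 𝟭 C }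
  exact ⟨L₀, rfl, L₀.cor510MonoCores_of (fun _ => ⟨Iso.refl _⟩) ⟨Iso.refl _⟩⟩

/-- **F-0138 calibrated**: some setting over `(Vmod, isArc)` satisfies the typed Cor 5.10 (iv)(a) if and only if `Vmod` is
nonempty (⇐ the diagonal setting on the large category `Type u`; ⇒ abc-iut-L4-t10's `not_cor510MonoCores_of_isEmpty`, valid
for every setting). [cite: MochizukiAbsTopIII2015, Cor 5.10 (iv)(a) p. 147] -/
theorem exists_cor510MonoCores_iff_nonempty :
    (∃ L : LogFrobeniusSetting Vmod isArc, L.Cor510MonoCores) ↔ Nonempty Vmod := by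
  refine ⟨fun ⟨L, hL⟩ => ?_, fun _ => ?_⟩
  · by_contra hV
    rw [not_nonempty_iff] at hV
    exact L.not_cor510MonoCores_of_isEmpty hL
  · obtain ⟨L, -, hL⟩ := exists_cor510MonoCores Vmod isArc (Type u)
    exact ⟨L, hL⟩

end LogFrobeniusSetting

end Literature.AnabelianGeometry.AbsoluteAnabelian
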